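import Literature.MathematicalPhysics.StatisticalMechanics.TorusFiniteRangeDecomposition
import Literature.Probability.LatticeModels.TorusFourierProofs
import HarnessLib

/-!
# Fourier calculus on the discrete torus `(ℤ/M)^d` in the conventions of the torus FRD statement

Topic `Literature/MathematicalPhysics/StatisticalMechanics`.  The named fact
`GradientFRD.TorusFRD` (`TorusFiniteRangeDecomposition.lean`; Buchholz, J. Funct. Anal. 275 (2018),
Thm 2.4) is stated with the Fourier transform `fourierCoeff 𝒞 κ = Σ_x 𝒞(x) e^{-ip(κ)·x}`,
`p_i = 2πκ̃_i/M` (symmetric representatives), the difference operators `fwdDiff`/`bwdDiff`, the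
convolution `conv` and the elliptic operator `ellOp A = ∇*A∇`.  This file identifies these with the
character calculus of `(ℤ/M)^d` (`Literature/Probability/LatticeModels/TorusFourierProofs.lean`,
characters `torusChar κ x = Π_i e^{2πi κ_i x_i/M}`) and proves the standard facts of Buchholz's §2
(p. 5–6: "translation invariant operators are diagonal in Fourier space"):

* `cexp_neg_dual_eq_conj_torusChar`, `fourierCoeff_eq_sum` — `e^{-ip(κ)·x̃} = conj χ_κ(x)`, so
  `fourierCoeff ψ κ = Σ_x ψ(x) conj χ_κ(x)`; Fourier inversion `fourierCoeff_inversion` and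
  injectivity `eq_of_fourierCoeff_eq`;
* multipliers: `fourierCoeff_fwdDiff` (`q_j(p) = e^{ip_j} − 1`), `fourierCoeff_bwdDiff` (`conj q_i`),
  `fourierCoeff_conv` (product), `fourierCoeff_ellOp` (`â(p) = Σ A_ij conj(q_i) q_j`, Buchholz (2.18));
* the symbol of `∇*A∇`: `symb A κ`, its real form `symbR` for symmetric `A` (`symb_eq_symbR`),
  `symbR_zero`, and the bounds `ω₀ |q|² ≤ â ≤ Ω₀ |q|²` for `A ∈ 𝓛(ω₀,Ω₀)` (`IsElliptic`),
  `|ḃ| ≤ |q|²` for `IsUnitSymm`, `(4/π²)|p|² ≤ |q|² ≤ |p|²` (Buchholz (2.19)–(2.20)), `|p_i| ≤ π`.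

Everything is proved; no named facts.

## References
* S. Buchholz, *Finite range decomposition for Gaussian measures with improved regularity*,
  J. Funct. Anal. 275 (2018), §2 (Fourier transform on `T_N`, (2.14)–(2.21)) [Buchholz2016].
-/

noncomputable section

namespace Literature.MathematicalPhysics.StatisticalMechanics.GradientFRD

open Finset Complex Literature.Probability.LatticeModels
open scoped Real ComplexConjugate BigOperators

variable {d M : ℕ} [NeZero M]

/-! ## The phase `e^{-ip·x}` is the conjugate character -/

/-- One coordinate: `e^{2πi κ̃ x̃ / M} = χ(κ x)` for the symmetric representatives `κ̃, x̃`.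
[cite: Buchholz2016, §2 (2.14)] -/
theorem stdAddChar_mul_eq_cexp_valMinAbs (κ x : ZMod M) :
    (ZMod.stdAddChar (κ * x) : ℂ) = cexp (2 * π * I * ((κ.valMinAbs * x.valMinAbs : ℤ) : ℂ) / M) := by
  have h : κ * x = (((κ.valMinAbs * x.valMinAbs : ℤ)) : ZMod M) := by
    simp [ZMod.coe_valMinAbs]
  rw [h, ZMod.stdAddChar_coe]

/-- `e^{-i p(κ)·x̃} = conj χ_κ(x)` with `p_i = 2π κ̃_i/M`. [cite: Buchholz2016, §2 (2.14)] -/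
theorem cexp_neg_dual_eq_conj_torusChar (κ x : Fin d → ZMod M) :
    cexp (-(I * ((∑ i, dualMomentum κ i * ((x i).valMinAbs : ℝ) : ℝ) : ℂ))) = conj (torusChar κ x) := by
  unfold torusChar
  rw [map_prod]
  have hterm : ∀ i, conj (ZMod.stdAddChar (κ i * x i) : ℂ) =
      cexp (-(I * (((dualMomentum κ i * ((x i).valMinAbs : ℝ)) : ℝ) : ℂ))) := by
    intro i
    rw [stdAddChar_mul_eq_cexp_valMinAbs, ← Complex.exp_conj]
    congr 1
    simp only [map_div₀, map_mul, map_ofNat, Complex.conj_ofReal, Complex.conj_I, map_natCast, map_intCast,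
      dualMomentum]
    push_cast
    ring
  simp_rw [hterm, ← Complex.exp_sum]
  congr 1
  push_cast
  rw [Finset.mul_sum, ← Finset.sum_neg_distrib]

/-- **The statement's Fourier transform is the character sum** `fourierCoeff ψ κ = Σ_x ψ(x) conj χ_κ(x)`.
[cite: Buchholz2016, §2 (2.14)] -/
theorem fourierCoeff_eq_sum (ψ : (Fin d → ZMod M) → ℝ) (κ : Fin d → ZMod M) :
    fourierCoeff ψ κ = ∑ x, (ψ x : ℂ) * conj (torusChar κ x) := by
  unfold fourierCoeff
  exact sum_congr rfl fun x _ => by rw [cexp_neg_dual_eq_conj_torusChar]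

/-- **Fourier inversion** `ψ(x) = M^{-d} Σ_κ ψ̂(κ) χ_κ(x)`. [cite: Buchholz2016, §2 (2.15)] -/
theorem fourierCoeff_inversion (ψ : (Fin d → ZMod M) → ℝ) (x : Fin d → ZMod M) :
    (ψ x : ℂ) = (((M : ℂ) ^ d))⁻¹ * ∑ κ, fourierCoeff ψ κ * torusChar κ x := by
  have h := torusFourier_inversion_holds (d := d) (L := M) (fun y => (ψ y : ℂ))
  have hx := congrFun h x
  rw [torusFourierInv_eq_sum_torusChar] at hx
  simp_rw [torusFourier_eq_sum_torusChar] at hx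
  simp_rw [fourierCoeff_eq_sum]
  exact hx.symm

/-- Two real functions with the same Fourier coefficients are equal. [cite: Buchholz2016, §2 (2.15)] -/
theorem eq_of_fourierCoeff_eq {ψ₁ ψ₂ : (Fin d → ZMod M) → ℝ} (h : ∀ κ, fourierCoeff ψ₁ κ = fourierCoeff ψ₂ κ) :
    ψ₁ = ψ₂ := by
  funext x
  have h1 := fourierCoeff_inversion ψ₁ x
  have h2 := fourierCoeff_inversion ψ₂ x
  simp_rw [h] at h1
  exact_mod_cast h1.trans h2.symm

/-! ## Multipliers of the difference operators -/

/-- The Fourier coefficient of a translate: `(ψ(· + v))^(κ) = χ_κ(v) ψ̂(κ)`. [cite: Buchholz2016, §2 (2.17)] -/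
theorem fourierCoeff_comp_add (ψ : (Fin d → ZMod M) → ℝ) (v κ : Fin d → ZMod M) :
    fourierCoeff (fun x => ψ (x + v)) κ = torusChar κ v * fourierCoeff ψ κ := by
  rw [fourierCoeff_eq_sum, fourierCoeff_eq_sum, Finset.mul_sum,
    ← Equiv.sum_comp (Equiv.addRight v) (fun i => torusChar κ v * ((ψ i : ℂ) * conj (torusChar κ i)))]
  refine sum_congr rfl fun x _ => ?_
  simp only [Equiv.coe_addRight, torusChar_add_right, map_mul]
  have h := torusChar_mul_conj κ v
  linear_combination (-(↑(ψ (x + v)) * conj (torusChar κ x))) * h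

/-- The mode factor `q_j(κ) = χ_κ(e_j) − 1 = e^{ip_j} − 1`. [cite: Buchholz2016, §2 (2.18)] -/
def qmode (κ : Fin d → ZMod M) (j : Fin d) : ℂ := torusChar κ (Pi.single j 1) - 1

/-- `(∇_j ψ)^(κ) = q_j(κ) ψ̂(κ)`. [cite: Buchholz2016, §2 (2.18)] -/
theorem fourierCoeff_fwdDiff (j : Fin d) (ψ : (Fin d → ZMod M) → ℝ) (κ : Fin d → ZMod M) :
    fourierCoeff (fwdDiff j ψ) κ = qmode κ j * fourierCoeff ψ κ := by
  have h1 : fourierCoeff (fwdDiff j ψ) κ = fourierCoeff (fun x => ψ (x + Pi.single j 1)) κ - fourierCoeff ψ κ := by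
    rw [fourierCoeff_eq_sum, fourierCoeff_eq_sum, fourierCoeff_eq_sum, ← sum_sub_distrib]
    refine sum_congr rfl fun x _ => ?_
    simp only [fwdDiff]; push_cast; ring
  rw [h1, fourierCoeff_comp_add, qmode]; ring

/-- `(∇_i^* ψ)^(κ) = conj(q_i(κ)) ψ̂(κ)`. [cite: Buchholz2016, §2 (2.18)] -/
theorem fourierCoeff_bwdDiff (i : Fin d) (ψ : (Fin d → ZMod M) → ℝ) (κ : Fin d → ZMod M) :
    fourierCoeff (bwdDiff i ψ) κ = conj (qmode κ i) * fourierCoeff ψ κ := by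
  have h1 : fourierCoeff (bwdDiff i ψ) κ = fourierCoeff (fun x => ψ (x + -Pi.single i 1)) κ - fourierCoeff ψ κ := by
    rw [fourierCoeff_eq_sum, fourierCoeff_eq_sum, fourierCoeff_eq_sum, ← sum_sub_distrib]
    refine sum_congr rfl fun x _ => ?_
    simp only [bwdDiff, sub_eq_add_neg]; push_cast; ring
  rw [h1, fourierCoeff_comp_add, qmode, torusChar_neg_right, map_sub, map_one]; ring

/-- **Convolution theorem** `(𝒞 ⋆ φ)^(κ) = 𝒞̂(κ) φ̂(κ)`. [cite: Buchholz2016, §2 (2.17)] -/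
theorem fourierCoeff_conv (K φ : (Fin d → ZMod M) → ℝ) (κ : Fin d → ZMod M) :
    fourierCoeff (conv K φ) κ = fourierCoeff K κ * fourierCoeff φ κ := by
  have hL : fourierCoeff (conv K φ) κ = ∑ y, ∑ x, (K (x - y) : ℂ) * (φ y : ℂ) * conj (torusChar κ x) := by
    rw [fourierCoeff_eq_sum]
    unfold conv
    push_cast
    simp_rw [Finset.sum_mul]
    exact Finset.sum_comm
  have hR : fourierCoeff K κ * fourierCoeff φ κ =
      ∑ y, ∑ z, ((K z : ℂ) * conj (torusChar κ z)) * ((φ y : ℂ) * conj (torusChar κ y)) := by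
    rw [fourierCoeff_eq_sum, fourierCoeff_eq_sum, Finset.sum_mul_sum, Finset.sum_comm]
  rw [hL, hR]
  refine sum_congr rfl fun y _ => ?_
  rw [← Equiv.sum_comp (Equiv.addRight y) (fun x => (K (x - y) : ℂ) * (φ y : ℂ) * conj (torusChar κ x))]
  refine sum_congr rfl fun z _ => ?_
  simp only [Equiv.coe_addRight, add_sub_cancel_right, torusChar_add_right, map_mul]
  ring

/-- The symbol of `∇*A∇`: `â(κ) = Σ_{ij} A_ij conj(q_i) q_j`. [cite: Buchholz2016, §2 (2.18)] -/
def symb (A : Matrix (Fin d) (Fin d) ℝ) (κ : Fin d → ZMod M) : ℂ :=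
  ∑ i, ∑ j, (A i j : ℂ) * conj (qmode κ i) * qmode κ j

/-- `(∇*A∇ ψ)^(κ) = â(κ) ψ̂(κ)`. [cite: Buchholz2016, §2 (2.18)] -/
theorem fourierCoeff_ellOp (A : Matrix (Fin d) (Fin d) ℝ) (ψ : (Fin d → ZMod M) → ℝ) (κ : Fin d → ZMod M) :
    fourierCoeff (ellOp A ψ) κ = symb A κ * fourierCoeff ψ κ := by
  have h : fourierCoeff (ellOp A ψ) κ = ∑ i, ∑ j, (A i j : ℂ) * fourierCoeff (bwdDiff i (fwdDiff j ψ)) κ := by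
    rw [fourierCoeff_eq_sum]
    unfold ellOp
    push_cast
    simp_rw [Finset.sum_mul]
    rw [Finset.sum_comm]
    refine sum_congr rfl fun i _ => ?_
    rw [Finset.sum_comm]
    refine sum_congr rfl fun j _ => ?_
    rw [fourierCoeff_eq_sum, Finset.mul_sum]
    refine sum_congr rfl fun x _ => ?_
    ring
  rw [h, symb, Finset.sum_mul]
  refine sum_congr rfl fun i _ => ?_
  rw [Finset.sum_mul]
  refine sum_congr rfl fun j _ => ?_
  rw [fourierCoeff_bwdDiff, fourierCoeff_fwdDiff]; ring

/-! ## The symbol: real form and bounds -/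

/-- The real form of the symbol for symmetric `A`:
`â(κ) = Σ A_ij (Re q_i Re q_j + Im q_i Im q_j)`. [cite: Buchholz2016, §2 (2.18)] -/
def symbR (A : Matrix (Fin d) (Fin d) ℝ) (κ : Fin d → ZMod M) : ℝ :=
  ∑ i, ∑ j, A i j * ((qmode κ i).re * (qmode κ j).re + (qmode κ i).im * (qmode κ j).im)

/-- `|q(κ)|² = Σ_j |q_j(κ)|²`. [cite: Buchholz2016, §2 (2.19)] -/
def qnormSq (κ : Fin d → ZMod M) : ℝ := ∑ j, ‖qmode κ j‖ ^ 2

/-- For symmetric `A` the symbol is real: `â = symbR`. [cite: Buchholz2016, §2 (2.18)] -/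
theorem symb_eq_symbR {A : Matrix (Fin d) (Fin d) ℝ} (hA : A.IsSymm) (κ : Fin d → ZMod M) :
    symb A κ = (symbR A κ : ℂ) := by
  -- split each summand into the symmetric real part and the antisymmetric imaginary part
  set r : Fin d → Fin d → ℝ := fun i j =>
    A i j * ((qmode κ i).re * (qmode κ j).im - (qmode κ i).im * (qmode κ j).re) with hr
  have hdec : ∀ i j, (A i j : ℂ) * conj (qmode κ i) * qmode κ j =
      ((A i j * ((qmode κ i).re * (qmode κ j).re + (qmode κ i).im * (qmode κ j).im) : ℝ) : ℂ) + (r i j : ℂ) * I := by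
    intro i j
    apply Complex.ext <;> simp [hr, Complex.conj_re, Complex.conj_im] <;> ring
  have hneg : ∀ i j, r j i = -r i j := by
    intro i j
    simp only [hr]
    rw [show A j i = A i j from hA.apply i j]
    ring
  have hS : ∑ i, ∑ j, (r i j : ℂ) = 0 := by
    have hswap : ∑ i, ∑ j, (r i j : ℂ) = ∑ j, ∑ i, (r i j : ℂ) := Finset.sum_comm
    have hflip : ∑ j, ∑ i, (r i j : ℂ) = -∑ j, ∑ i, (r j i : ℂ) := by
      rw [← Finset.sum_neg_distrib]
      refine sum_congr rfl fun j _ => ?_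
      rw [← Finset.sum_neg_distrib]
      refine sum_congr rfl fun i _ => ?_
      rw [hneg j i]; push_cast; ring
    rw [hflip] at hswap
    linear_combination hswap / 2
  have hanti : ∑ i, ∑ j, (r i j : ℂ) * I = 0 := by
    simp_rw [← Finset.sum_mul]
    rw [hS, zero_mul]
  unfold symb
  simp_rw [hdec, Finset.sum_add_distrib]
  rw [hanti, add_zero]
  unfold symbR
  push_cast
  rfl

/-- **Ellipticity of the symbol**: `ω₀ |q|² ≤ â ≤ Ω₀ |q|²` for `A ∈ 𝓛(ω₀, Ω₀)` (apply the quadratic-form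
bounds to `Re q` and `Im q`). [cite: Buchholz2016, §2 (2.19)–(2.20)] -/
theorem symbR_bounds {ω₀ Ω₀ : ℝ} {A : Matrix (Fin d) (Fin d) ℝ} (hA : IsElliptic ω₀ Ω₀ A) (κ : Fin d → ZMod M) :
    ω₀ * qnormSq κ ≤ symbR A κ ∧ symbR A κ ≤ Ω₀ * qnormSq κ := by
  obtain ⟨_, hq⟩ := hA
  have hre := hq fun j => (qmode κ j).re
  have him := hq fun j => (qmode κ j).im
  have hsplit : symbR A κ = (∑ i, ∑ j, (qmode κ i).re * A i j * (qmode κ j).re) +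
      ∑ i, ∑ j, (qmode κ i).im * A i j * (qmode κ j).im := by
    unfold symbR
    rw [← Finset.sum_add_distrib]
    refine sum_congr rfl fun i _ => ?_
    rw [← Finset.sum_add_distrib]
    refine sum_congr rfl fun j _ => ?_
    ring
  have hnorm : qnormSq κ = ∑ j, (qmode κ j).re ^ 2 + ∑ j, (qmode κ j).im ^ 2 := by
    unfold qnormSq
    rw [← Finset.sum_add_distrib]
    refine sum_congr rfl fun j _ => ?_
    rw [← Complex.normSq_eq_norm_sq, Complex.normSq_apply]; ring
  rw [hsplit, hnorm]
  constructor <;> nlinarith [hre.1, hre.2, him.1, him.2]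

/-- `|ḃ(κ)| ≤ |q|²` for a symmetric direction of norm `≤ 1`. [cite: Buchholz2016, Thm 2.4 (‖Ȧ‖ ≤ 1)] -/
theorem abs_symbR_le {B : Matrix (Fin d) (Fin d) ℝ} (hB : IsUnitSymm B) (κ : Fin d → ZMod M) :
    |symbR B κ| ≤ qnormSq κ := by
  obtain ⟨_, hq⟩ := hB
  have hre := hq fun j => (qmode κ j).re
  have him := hq fun j => (qmode κ j).im
  have hsplit : symbR B κ = (∑ i, ∑ j, (qmode κ i).re * B i j * (qmode κ j).re) +
      ∑ i, ∑ j, (qmode κ i).im * B i j * (qmode κ j).im := by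
    unfold symbR
    rw [← Finset.sum_add_distrib]
    refine sum_congr rfl fun i _ => ?_
    rw [← Finset.sum_add_distrib]
    refine sum_congr rfl fun j _ => ?_
    ring
  have hnorm : qnormSq κ = ∑ j, (qmode κ j).re ^ 2 + ∑ j, (qmode κ j).im ^ 2 := by
    unfold qnormSq
    rw [← Finset.sum_add_distrib]
    refine sum_congr rfl fun j _ => ?_
    rw [← Complex.normSq_eq_norm_sq, Complex.normSq_apply]; ring
  rw [hsplit, hnorm]
  exact (abs_add_le _ _).trans (add_le_add hre him)

/-- The dual momentum is at most `π` in absolute value (symmetric representatives).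
[cite: Buchholz2016, §2 (dual torus)] -/
theorem abs_dualMomentum_le (κ : Fin d → ZMod M) (i : Fin d) : |dualMomentum κ i| ≤ π := by
  have hM : (0 : ℝ) < M := by exact_mod_cast Nat.pos_of_ne_zero (NeZero.ne M)
  have hk : |((κ i).valMinAbs : ℝ)| ≤ (M : ℝ) / 2 := by
    have hc : (((κ i).valMinAbs.natAbs : ℤ) : ℝ) = |((κ i).valMinAbs : ℝ)| := by
      rw [Int.natCast_natAbs, Int.cast_abs]
    rw [← hc]
    have h := ZMod.natAbs_valMinAbs_le (κ i)
    calc (((κ i).valMinAbs.natAbs : ℤ) : ℝ) = (((κ i).valMinAbs.natAbs : ℕ) : ℝ) := Int.cast_natCast _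
      _ ≤ ((M / 2 : ℕ) : ℝ) := by exact_mod_cast h
      _ ≤ (M : ℝ) / 2 := Nat.cast_div_le
  unfold dualMomentum
  rw [abs_div, Nat.abs_cast, abs_mul, abs_mul, abs_two, abs_of_pos Real.pi_pos, div_le_iff₀ hM]
  nlinarith [Real.pi_pos]

/-- `χ_κ(e_j) = e^{i p_j}`. [cite: Buchholz2016, §2 (2.18)] -/
theorem torusChar_single (κ : Fin d → ZMod M) (j : Fin d) :
    torusChar κ (Pi.single j 1) = cexp (I * (dualMomentum κ j : ℂ)) := by
  unfold torusChar
  rw [Finset.prod_eq_single j (fun i _ hij => by rw [Pi.single_eq_of_ne hij, mul_zero, AddChar.map_zero_eq_one])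
    (fun h => absurd (Finset.mem_univ j) h), Pi.single_eq_same, mul_one]
  conv_lhs => rw [← ZMod.coe_valMinAbs (κ j)]
  rw [ZMod.stdAddChar_coe]
  congr 1
  simp only [dualMomentum]
  push_cast
  ring

/-- `|q_j(κ)|² = 4 sin²(p_j/2)`. [cite: Buchholz2016, §2 (2.19)] -/
theorem norm_qmode_sq (κ : Fin d → ZMod M) (j : Fin d) :
    ‖qmode κ j‖ ^ 2 = 4 * Real.sin (dualMomentum κ j / 2) ^ 2 := by
  rw [qmode, torusChar_single, Complex.norm_exp_I_mul_ofReal_sub_one, Real.norm_eq_abs, sq_abs]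
  ring

/-- **`(4/π²)|p|² ≤ |q|² ≤ |p|²`** (Jordan's inequality coordinatewise). [cite: Buchholz2016, §2 (2.19)–(2.20)] -/
theorem qnormSq_bounds (κ : Fin d → ZMod M) :
    4 / π ^ 2 * momNorm κ ^ 2 ≤ qnormSq κ ∧ qnormSq κ ≤ momNorm κ ^ 2 := by
  have hmom : momNorm κ ^ 2 = ∑ i, dualMomentum κ i ^ 2 := by
    rw [momNorm, Real.sq_sqrt (sum_nonneg fun i _ => sq_nonneg _)]
  rw [hmom, qnormSq, Finset.mul_sum]
  constructor
  · refine sum_le_sum fun j _ => ?_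
    rw [norm_qmode_sq]
    have hp := abs_dualMomentum_le κ j
    -- `|sin(p/2)| ≥ |p|/π`
    have h := Real.mul_le_sin (x := |dualMomentum κ j| / 2) (by positivity) (by linarith)
    have hs : Real.sin (|dualMomentum κ j| / 2) ^ 2 = Real.sin (dualMomentum κ j / 2) ^ 2 := by
      rcases le_or_gt 0 (dualMomentum κ j) with h0 | h0
      · rw [abs_of_nonneg h0]
      · rw [abs_of_neg h0, neg_div, Real.sin_neg, neg_sq]
    have h2 : (2 / π * (|dualMomentum κ j| / 2)) ^ 2 ≤ Real.sin (|dualMomentum κ j| / 2) ^ 2 :=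
      pow_le_pow_left₀ (by positivity) h (2)
    rw [hs] at h2
    have : 4 / π ^ 2 * dualMomentum κ j ^ 2 = 4 * (2 / π * (|dualMomentum κ j| / 2)) ^ 2 := by
      rw [mul_pow, div_pow, div_pow, sq_abs]; ring
    rw [this]
    linarith
  · refine sum_le_sum fun j _ => ?_
    rw [norm_qmode_sq]
    have h := Real.sin_sq_le_sq (x := dualMomentum κ j / 2)
    nlinarith

/-- `q_j(0) = 0`, so `â(0) = 0`: the symbol annihilates the zero mode. [cite: Buchholz2016, §2 (2.18)] -/
theorem qmode_zero (j : Fin d) : qmode (0 : Fin d → ZMod M) j = 0 := by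
  rw [qmode, torusChar_zero_left, sub_self]

/-- `â(0) = 0` (real form). [cite: Buchholz2016, §2 (2.18)] -/
theorem symbR_zero (A : Matrix (Fin d) (Fin d) ℝ) : symbR A (0 : Fin d → ZMod M) = 0 := by
  unfold symbR; simp [qmode_zero]

/-- `â(0) = 0` (complex form). [cite: Buchholz2016, §2 (2.18)] -/
theorem symb_zero (A : Matrix (Fin d) (Fin d) ℝ) : symb A (0 : Fin d → ZMod M) = 0 := by
  unfold symb; simp [qmode_zero]

/-- For `κ ≠ 0` the mode norm is positive: `|q(κ)|² > 0`. [cite: Buchholz2016, §2 (2.20)] -/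
theorem qnormSq_pos {κ : Fin d → ZMod M} (hκ : κ ≠ 0) : 0 < qnormSq κ := by
  obtain ⟨j, hj⟩ : ∃ j, κ j ≠ 0 := by
    by_contra h
    push Not at h
    exact hκ (funext h)
  have hM : (0 : ℝ) < M := by exact_mod_cast Nat.pos_of_ne_zero (NeZero.ne M)
  have hp0 : dualMomentum κ j ≠ 0 := by
    unfold dualMomentum
    have : ((κ j).valMinAbs : ℝ) ≠ 0 := by exact_mod_cast (mt (ZMod.valMinAbs_eq_zero (κ j)).1 hj)
    positivity
  have hpπ := abs_dualMomentum_le κ j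
  have hsin : Real.sin (dualMomentum κ j / 2) ≠ 0 := by
    intro h0
    rw [Real.sin_eq_zero_iff] at h0
    obtain ⟨n, hn⟩ := h0
    have habs : |(n : ℝ) * π| ≤ π / 2 := by rw [hn, abs_div, abs_two]; linarith
    have hn0 : n = 0 := by
      rw [abs_mul, abs_of_pos Real.pi_pos] at habs
      have : |(n : ℝ)| < 1 := by nlinarith [Real.pi_pos]
      have : |n| < 1 := by exact_mod_cast this
      rw [abs_lt] at this; omega
    rw [hn0, Int.cast_zero, zero_mul] at hn
    exact hp0 (by linarith)
  unfold qnormSq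
  refine lt_of_lt_of_le ?_ (Finset.single_le_sum (f := fun j => ‖qmode κ j‖ ^ 2) (fun j _ => sq_nonneg _)
    (Finset.mem_univ j))
  rw [norm_qmode_sq]
  positivity

/-- For `κ ≠ 0` and elliptic `A` the symbol is positive. [cite: Buchholz2016, §2 (2.20)] -/
theorem symbR_pos {ω₀ Ω₀ : ℝ} {A : Matrix (Fin d) (Fin d) ℝ} (hA : IsElliptic ω₀ Ω₀ A) (hω : 0 < ω₀)
    {κ : Fin d → ZMod M} (hκ : κ ≠ 0) : 0 < symbR A κ :=
  lt_of_lt_of_le (mul_pos hω (qnormSq_pos hκ)) (symbR_bounds hA κ).1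

/-- The symbol of `A + sB` is affine in `s`: `symbR (A + s•B) = symbR A + s symbR B`.
[cite: Buchholz2016, App. A (proof of Thm 2.3, linearity of the Fourier transform in A)] -/
theorem symbR_add_smul (A B : Matrix (Fin d) (Fin d) ℝ) (s : ℝ) (κ : Fin d → ZMod M) :
    symbR (A + s • B) κ = symbR A κ + s * symbR B κ := by
  unfold symbR
  simp only [Matrix.add_apply, Matrix.smul_apply, smul_eq_mul]
  rw [Finset.mul_sum, ← Finset.sum_add_distrib]
  refine sum_congr rfl fun i _ => ?_
  rw [Finset.mul_sum, ← Finset.sum_add_distrib]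
  refine sum_congr rfl fun j _ => ?_
  ring

end Literature.MathematicalPhysics.StatisticalMechanics.GradientFRD

end
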